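import Summits.ResolutionOfSingularities.ResolutionOfSingularities.Theorems.EquisingularLiftEquisingularLiftNatAxisSupport
import Summits.ResolutionOfSingularities.ResolutionOfSingularities.Theorems.EquisingularLiftEquisingularLiftNatAxisStalks
import Summits.ResolutionOfSingularities.ResolutionOfSingularities.Theorems.EquisingularLiftEquisingularLiftNatAxisSection
import HarnessLib

/-!
# [OURS · L1 W4.5(b) · EL♮(3)] HSUB(ReachTC⁺)₃ brick `inv_base`, part B6b-glue: the AXIS SECTION through the cone point
# (res-type-100's B6b text, instantiated), with `𝒪_{X₁,p_c} ⧸ (C_axis)_{p_c} ≅ O` built from `θR : 𝒪_{X′,jx}/(c) ≅ O`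

Crux chain w45b (cell `res-hironaka`, slot W4.5(b)), working crux **EL♮** = stmt-ResolutionOfSingularities-20038, child **EL♮(3)** =
stmt-ResolutionOfSingularities-20148, route EquisingularLift, line `sections`, registered stub `stub_elnat_tcPlusPointResolution`;
assembly HSUB(ReachTC⁺)₃ (driver p526242, INV DEFS v3 p532383), brick `inv_base` (res-type-100, B8 `tcPlus_member_centred`),
sub-brick **B6b ★ T-AXIS-SECTION**. The generic section theorem is res-D-pv-051's `exists_axisSection` (p542434); its inputs are
supplied by res-type-100's `axis_stalks` / `axis_fibre` (T-AXIS-STALKS, p542871), res-D-pv-029's `hsupp`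
(`eq_conePoint_of_mem_support_axis_of_apply_eq_closedPoint`, T-AXIS-SUPPORT) and — the one input nobody had — the ring
isomorphism `eO : 𝒪_{X₁,p_c} ⧸ (C_axis)_{p_c} ≃+* O`, constructed HERE from the chart-`0` presentation of `𝒪_{X₁,p_c}` (B6a,
p541628) and the frame quotient `θR : 𝒪_{X′,jx} ⧸ (c) ≃+* O` that the centred-member context carries (…NatCarrierDeltaFrameAdapted).
This file is the INSTANTIATION GLUE (res-L1-w45b-plan-1 desk order 2026-08-27T15:30:32Z (a)). HONEST FRAMING: OURS; NOT a statement of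
H. Hironaka's manuscript or of any paper; Stacks 0804 / 0BIQ bookkeeping; AI-written kernel lemmas, weaker than expert review. No
`sorry`; standard axioms; DEF-FREE. `--supports stmt-ResolutionOfSingularities-20148 --as helper`.

WHAT (namespace `…Cruxes.EquisingularLiftNat.Sections`; `B₀ = R[I/c₀] = blowupAlgebra (c) c₀`, axis ideal
`𝔞 = (c₀/1) ⊔ (c₁/c₀, c₂/c₀) ⊆ B₀`):
* ring level (§1): `frac_mem_span_pair`, `exists_sub_algebraMap_mem_axisIdeal` (every element of `B₀` is a constant mod `𝔞`:
  `B₀` is generated by the `c_l/c₀`), `span_range_le_comap_axisIdeal` / `comap_axisIdeal_le_span_range` /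
  `comap_axisIdeal_eq_span_range` (**`R ∩ 𝔞 = (c)`** for `c` quasi-regular — the content of Stacks 0BIQ, read off the tree's
  `blowupAlgebra.eval_mem_span_algebraMap_iff` on the constant coefficient), `quotientMap_axisIdeal_bijective` (`R/(c) ≅ B₀/𝔞`);
* §2 **`nonempty_quotient_map_axisIdeal_ringEquiv`** — for `R` local, `θR : R/(c) ≃+* O` (`O` local) and a local ring `S`
  presented as `(B₀)_𝔔` along `χ` with `𝔔 ∩ R = 𝔪_R` and `χ(c_l/c₀) ∈ 𝔪_S`: **`S ⧸ 𝔞·S ≃+* O`**. The surjection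
  `Ψ : B₀ → B₀/𝔞 ≅ R/(c) ≅ O` inverts `B₀ ∖ 𝔔`, because `Ψ⁻¹(𝔪_O)` is a vertex prime over `𝔪_R` and the vertex prime is unique
  (res-L1-w45b-stub-2's `chartPrime_eq_of_forall_frac_mem`, p540294), so `Ψ` extends to `S` (`IsLocalization.lift`), surjective
  with kernel `𝔞·S`;
* §3 **`exists_axisSection_conePoint`** — res-type-100's B6b (OFFER 2026-08-27T14:56:25Z) at the cone point `p_c = j₂ y′`, in the
  binders of B6a / T-AXIS-STALKS: a section `s_c : Spec O → X₁` of `τ₁ ≫ r′` through `p_c` with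
  `(E ⊔ St L₁) ⊔ St L₂ ≤ ker s_c`, `(ker s_c)_{p_c} = χ₁((c₀/1) ⊔ (c₁/c₀, c₂/c₀))`, `V(ker s_c)` regular and `O`-flat.

References: The Stacks Project, Tags 0804, 0BIQ, 052P; EGA IV 18.5.17 (via p542434); tree `BlowupAlgebraPresentation.lean`;
p540294, p541628, p542434, p542871, T-AXIS-SUPPORT (…NatAxisSupport).
-/

set_option linter.dupNamespace false -- mandated namespace `Summit.<Summit>.<Problem>` of this single-conjunct summit

noncomputable section

open CategoryTheory CategoryTheory.Limits AlgebraicGeometry TopologicalSpace IsLocalRing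
open Literature.AlgebraicGeometry.Resolution
open AlgebraicGeometry.Scheme.IdealSheafData

namespace Summit.ResolutionOfSingularities.ResolutionOfSingularities.Cruxes.EquisingularLiftNat.Sections

universe u

/-! ## 1. Ring level: the axis ideal `𝔞 = (c₀/1, c₁/c₀, c₂/c₀)` of the chart algebra `R[I/c₀]` -/

section Ring

variable {R : Type u} [CommRing R] (c : Fin 3 → R)

/-- The two chart coordinates `c₁/c₀, c₂/c₀` lie in `(c₁/c₀, c₂/c₀)`. [folklore] -/
theorem frac_mem_span_pair : ∀ l : Fin 3, l ≠ 0 →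
    blowupAlgebra.frac c 0 l ∈ (Ideal.span {blowupAlgebra.frac c 0 1, blowupAlgebra.frac c 0 2} :
      Ideal (blowupAlgebra (Ideal.span (Set.range c)) (c 0))) := by
  intro l
  fin_cases l <;> intro hl
  · exact absurd rfl hl
  · exact Ideal.subset_span (by simp)
  · exact Ideal.subset_span (by simp)

/-- **Every element of the chart algebra `R[I/c₀]` is a constant modulo the axis ideal** `(c₀/1, c₁/c₀, c₂/c₀)` (indeed modulo
`(c₁/c₀, c₂/c₀)`: `R[I/c₀]` is generated over `R` by the `c_l/c₀`, tree `blowupAlgebra.eval_surjective`). [cite: StacksProject, Tag 052P] -/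
theorem exists_sub_algebraMap_mem_axisIdeal (b : blowupAlgebra (Ideal.span (Set.range c)) (c 0)) :
    ∃ r : R, b - algebraMap R (blowupAlgebra (Ideal.span (Set.range c)) (c 0)) r ∈
      Ideal.span {algebraMap R (blowupAlgebra (Ideal.span (Set.range c)) (c 0)) (c 0)} ⊔
        Ideal.span {blowupAlgebra.frac c 0 1, blowupAlgebra.frac c 0 2} := by
  set 𝔞 : Ideal (blowupAlgebra (Ideal.span (Set.range c)) (c 0)) :=
    Ideal.span {algebraMap R (blowupAlgebra (Ideal.span (Set.range c)) (c 0)) (c 0)} ⊔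
      Ideal.span {blowupAlgebra.frac c 0 1, blowupAlgebra.frac c 0 2} with h𝔞
  obtain ⟨h, rfl⟩ := blowupAlgebra.eval_surjective c 0 b
  refine ⟨MvPolynomial.constantCoeff h, ?_⟩
  rw [← Ideal.Quotient.eq]
  have key : (Ideal.Quotient.mk 𝔞).comp (blowupAlgebra.eval c 0).toRingHom =
      ((Ideal.Quotient.mk 𝔞).comp (algebraMap R _)).comp MvPolynomial.constantCoeff := by
    refine MvPolynomial.ringHom_ext (fun r => ?_) (fun j => ?_)
    · simp only [RingHom.comp_apply, AlgHom.toRingHom_eq_coe, RingHom.coe_coe, blowupAlgebra.eval_C,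
        MvPolynomial.constantCoeff_C]
    · simp only [RingHom.comp_apply, AlgHom.toRingHom_eq_coe, RingHom.coe_coe, blowupAlgebra.eval_X,
        MvPolynomial.constantCoeff_X, map_zero]
      rw [Ideal.Quotient.eq_zero_iff_mem]
      exact Ideal.mem_sup_right (frac_mem_span_pair c j.1 j.2)
  simpa only [RingHom.comp_apply, AlgHom.toRingHom_eq_coe, RingHom.coe_coe] using RingHom.congr_fun key h

/-- `(c) ⊆ R ∩ (c₀/1, c₁/c₀, c₂/c₀)`: every `c_i/1` lies in `(c)·R[I/c₀] = (c₀/1)`. [cite: StacksProject, Tag 052P] -/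
theorem span_range_le_comap_axisIdeal :
    Ideal.span (Set.range c) ≤
      (Ideal.span {algebraMap R (blowupAlgebra (Ideal.span (Set.range c)) (c 0)) (c 0)} ⊔
        Ideal.span {blowupAlgebra.frac c 0 1, blowupAlgebra.frac c 0 2}).comap
        (algebraMap R (blowupAlgebra (Ideal.span (Set.range c)) (c 0))) := by
  rw [Ideal.span_le]
  rintro _ ⟨i, rfl⟩
  rw [SetLike.mem_coe, Ideal.mem_comap]
  have hmem : algebraMap R (blowupAlgebra (Ideal.span (Set.range c)) (c 0)) (c i) ∈
      (Ideal.span (Set.range c)).map (algebraMap R (blowupAlgebra (Ideal.span (Set.range c)) (c 0))) :=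
    Ideal.mem_map_of_mem _ (Ideal.subset_span ⟨i, rfl⟩)
  rw [map_blowupAlgebra_eq_span (blowupAlgebra.mem_span_range c 0)] at hmem
  exact Ideal.mem_sup_left hmem

/-- **`R ∩ (c₀/1, c₁/c₀, c₂/c₀) ⊆ (c)` for `c` quasi-regular**: if `r/1 = a + h₁(c/c₀)·c₁/c₀ + h₂(c/c₀)·c₂/c₀` with
`a ∈ (c₀/1)`, then `H := r − h₁T₁ − h₂T₂` has `H(c/c₀) ∈ (c₀/1)`, so all coefficients of `H` lie in `(c)` (tree
`blowupAlgebra.eval_mem_span_algebraMap_iff`, Stacks 0BIQ), in particular the constant one, `r`. [cite: StacksProject, Tag 0BIQ] -/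
theorem comap_axisIdeal_le_span_range (hc : IsQuasiRegular c) :
    (Ideal.span {algebraMap R (blowupAlgebra (Ideal.span (Set.range c)) (c 0)) (c 0)} ⊔
        Ideal.span {blowupAlgebra.frac c 0 1, blowupAlgebra.frac c 0 2}).comap
        (algebraMap R (blowupAlgebra (Ideal.span (Set.range c)) (c 0))) ≤ Ideal.span (Set.range c) := by
  intro r hr
  rw [Ideal.mem_comap, Submodule.mem_sup] at hr
  obtain ⟨a, ha, b, hb, hab⟩ := hr
  rw [Ideal.mem_span_pair] at hb
  obtain ⟨β₁, β₂, rfl⟩ := hb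
  obtain ⟨h₁, rfl⟩ := blowupAlgebra.eval_surjective c 0 β₁
  obtain ⟨h₂, rfl⟩ := blowupAlgebra.eval_surjective c 0 β₂
  set H : MvPolynomial {j : Fin 3 // j ≠ 0} R :=
    MvPolynomial.C r - (h₁ * MvPolynomial.X ⟨1, by decide⟩ + h₂ * MvPolynomial.X ⟨2, by decide⟩) with hHdef
  have hH : blowupAlgebra.eval c 0 H = a := by
    rw [hHdef, map_sub, map_add, map_mul, map_mul, blowupAlgebra.eval_C, blowupAlgebra.eval_X, blowupAlgebra.eval_X,
      ← hab]
    dsimp only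
    ring
  have hmem : blowupAlgebra.eval c 0 H ∈
      Ideal.span {algebraMap R (blowupAlgebra (Ideal.span (Set.range c)) (c 0)) (c 0)} := by
    rw [hH]; exact ha
  have hcoef := (blowupAlgebra.eval_mem_span_algebraMap_iff c 0 hc H).mp hmem 0
  have h0 : MvPolynomial.coeff 0 H = MvPolynomial.constantCoeff H := rfl
  rw [h0, hHdef] at hcoef
  simpa only [map_sub, map_add, map_mul, MvPolynomial.constantCoeff_C, MvPolynomial.constantCoeff_X, mul_zero,
    add_zero, sub_zero] using hcoef

/-- **`R ∩ (c₀/1, c₁/c₀, c₂/c₀) = (c)`** for `c` quasi-regular. [cite: StacksProject, Tag 0BIQ] -/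
theorem comap_axisIdeal_eq_span_range (hc : IsQuasiRegular c) :
    (Ideal.span {algebraMap R (blowupAlgebra (Ideal.span (Set.range c)) (c 0)) (c 0)} ⊔
        Ideal.span {blowupAlgebra.frac c 0 1, blowupAlgebra.frac c 0 2}).comap
        (algebraMap R (blowupAlgebra (Ideal.span (Set.range c)) (c 0))) = Ideal.span (Set.range c) :=
  le_antisymm (comap_axisIdeal_le_span_range c hc) (span_range_le_comap_axisIdeal c)

/-- **`R/(c) → R[I/c₀]/(c₀/1, c₁/c₀, c₂/c₀)` is bijective** for `c` quasi-regular. [cite: StacksProject, Tag 0BIQ] -/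
theorem quotientMap_axisIdeal_bijective (hc : IsQuasiRegular c) :
    Function.Bijective (Ideal.quotientMap
      (Ideal.span {algebraMap R (blowupAlgebra (Ideal.span (Set.range c)) (c 0)) (c 0)} ⊔
        Ideal.span {blowupAlgebra.frac c 0 1, blowupAlgebra.frac c 0 2})
      (algebraMap R (blowupAlgebra (Ideal.span (Set.range c)) (c 0))) (span_range_le_comap_axisIdeal c)) := by
  refine ⟨Ideal.quotientMap_injective' (comap_axisIdeal_le_span_range c hc), fun q => ?_⟩
  obtain ⟨b, rfl⟩ := Ideal.Quotient.mk_surjective q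
  obtain ⟨r, hr⟩ := exists_sub_algebraMap_mem_axisIdeal c b
  exact ⟨Ideal.Quotient.mk _ r, by rw [Ideal.quotientMap_mk]; exact (Ideal.Quotient.eq.mpr hr).symm⟩

end Ring

/-! ## 2. The quotient of a local ring of the chart by the axis ideal is `≅ O` -/

/-- **The local ring at the vertex point modulo the axis ideal is `≅ O`.** Let `R` be local, `c = (c₀,c₁,c₂)` quasi-regular in `R`
with `θR : R/(c) ≃+* O`, `O` local; `S` a local ring presented as the localisation of `R[I/c₀]` at a prime `𝔔` over `𝔪_R`
along `χ`, with `χ(c_l/c₀) ∈ 𝔪_S` (`l = 1, 2`). Then `S ⧸ (c₀/1, c₁/c₀, c₂/c₀)·S ≃+* O`: the surjection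
`Ψ : R[I/c₀] → R[I/c₀]/𝔞 ≅ R/(c) ≅ O` inverts `R[I/c₀] ∖ 𝔔` (the prime `Ψ⁻¹ 𝔪_O` is a vertex prime over `𝔪_R`, hence `= 𝔔` by
the uniqueness of the vertex prime, `chartPrime_eq_of_forall_frac_mem`), so it extends to `S`, surjective with kernel `𝔞·S`.
[cite: StacksProject, Tag 0804] -/
theorem nonempty_quotient_map_axisIdeal_ringEquiv {R : Type u} [CommRing R] [IsLocalRing R] (c : Fin 3 → R)
    (hc : IsQuasiRegular c) {O : Type u} [CommRing O] [IsLocalRing O]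
    (θR : (R ⧸ Ideal.span (Set.range c)) ≃+* O) {S : Type u} [CommRing S] [IsLocalRing S]
    (𝔔 : PrimeSpectrum (blowupAlgebra (Ideal.span (Set.range c)) (c 0)))
    (χ : blowupAlgebra (Ideal.span (Set.range c)) (c 0) →+* S)
    (hloc : @IsLocalization.AtPrime _ _ S _ χ.toAlgebra 𝔔.asIdeal _)
    (h𝔔 : 𝔔.asIdeal.comap (algebraMap _ (blowupAlgebra (Ideal.span (Set.range c)) (c 0))) = maximalIdeal R)
    (hu : ∀ l : Fin 3, l ≠ 0 → χ (blowupAlgebra.frac c 0 l) ∈ maximalIdeal S) :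
    Nonempty ((S ⧸ (Ideal.span {algebraMap R (blowupAlgebra (Ideal.span (Set.range c)) (c 0)) (c 0)} ⊔
      Ideal.span {blowupAlgebra.frac c 0 1, blowupAlgebra.frac c 0 2}).map χ) ≃+* O) := by
  set 𝔞 : Ideal (blowupAlgebra (Ideal.span (Set.range c)) (c 0)) :=
    Ideal.span {algebraMap R (blowupAlgebra (Ideal.span (Set.range c)) (c 0)) (c 0)} ⊔
      Ideal.span {blowupAlgebra.frac c 0 1, blowupAlgebra.frac c 0 2} with h𝔞
  -- `eρ : R/(c) ≅ B/𝔞` and the surjection `Ψ : B → O` with kernel `𝔞`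
  let eρ : (R ⧸ Ideal.span (Set.range c)) ≃+* blowupAlgebra (Ideal.span (Set.range c)) (c 0) ⧸ 𝔞 :=
    RingEquiv.ofBijective (Ideal.quotientMap 𝔞 (algebraMap R (blowupAlgebra (Ideal.span (Set.range c)) (c 0)))
      (span_range_le_comap_axisIdeal c)) (quotientMap_axisIdeal_bijective c hc)
  let Ψ : blowupAlgebra (Ideal.span (Set.range c)) (c 0) →+* O :=
    θR.toRingHom.comp (eρ.symm.toRingHom.comp (Ideal.Quotient.mk 𝔞))
  have hΨ : ∀ b, Ψ b = θR (eρ.symm (Ideal.Quotient.mk 𝔞 b)) := fun b => rfl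
  have heρ : ∀ r : R, eρ (Ideal.Quotient.mk _ r) =
      Ideal.Quotient.mk 𝔞 (algebraMap R (blowupAlgebra (Ideal.span (Set.range c)) (c 0)) r) := fun r =>
    Ideal.quotientMap_mk (J := Ideal.span (Set.range c)) (I := 𝔞)
      (f := algebraMap R (blowupAlgebra (Ideal.span (Set.range c)) (c 0))) (H := span_range_le_comap_axisIdeal c) (x := r)
  have hΨalg : ∀ r : R, Ψ (algebraMap R (blowupAlgebra (Ideal.span (Set.range c)) (c 0)) r) = θR (Ideal.Quotient.mk _ r) := fun r => by
    rw [hΨ, ← heρ, RingEquiv.symm_apply_apply]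
  have hΨker : ∀ b, Ψ b = 0 ↔ b ∈ 𝔞 := fun b => by
    rw [hΨ, map_eq_zero_iff _ θR.injective, map_eq_zero_iff _ eρ.symm.injective, Ideal.Quotient.eq_zero_iff_mem]
  have hΨsurj : Function.Surjective Ψ := fun o => by
    obtain ⟨q, hq⟩ := θR.surjective o
    obtain ⟨b, hb⟩ := Ideal.Quotient.mk_surjective (eρ q)
    exact ⟨b, by rw [hΨ, hb, RingEquiv.symm_apply_apply, hq]⟩
  -- the prime `𝔑 = Ψ⁻¹ 𝔪_O` is the vertex prime `𝔔`
  set 𝔑 : Ideal (blowupAlgebra (Ideal.span (Set.range c)) (c 0)) := (maximalIdeal O).comap Ψ with h𝔑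
  have hcompR : Function.Surjective (Ψ.comp (algebraMap R (blowupAlgebra (Ideal.span (Set.range c)) (c 0)))) := fun o => by
    obtain ⟨q, hq⟩ := θR.surjective o
    obtain ⟨r, rfl⟩ := Ideal.Quotient.mk_surjective q
    exact ⟨r, by rw [RingHom.comp_apply, hΨalg, hq]⟩
  have h𝔑R : 𝔑.comap (algebraMap R (blowupAlgebra (Ideal.span (Set.range c)) (c 0))) = maximalIdeal R := by
    rw [h𝔑, Ideal.comap_comap]
    haveI := Ideal.comap_isMaximal_of_surjective (Ψ.comp (algebraMap R (blowupAlgebra (Ideal.span (Set.range c)) (c 0)))) hcompR (K := maximalIdeal O)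
    exact IsLocalRing.eq_maximalIdeal this
  have hfr𝔑 : ∀ l : Fin 3, l ≠ 0 → blowupAlgebra.frac c 0 l ∈ 𝔑 := fun l hl => by
    rw [h𝔑, Ideal.mem_comap, (hΨker _).mpr (Ideal.mem_sup_right (frac_mem_span_pair c l hl))]
    exact zero_mem _
  have hfr𝔔 : ∀ l : Fin 3, l ≠ 0 → blowupAlgebra.frac c 0 l ∈ 𝔔.asIdeal := fun l hl =>
    (mem_chartPrime_iff_apply_mem_maximalIdeal 𝔔 χ hloc _).mpr (hu l hl)
  have h𝔑𝔔 : 𝔑 = 𝔔.asIdeal := chartPrime_eq_of_forall_frac_mem c 0 𝔑 𝔔.asIdeal h𝔑R h𝔔 hfr𝔑 hfr𝔔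
  -- `Ψ` inverts `B ∖ 𝔔`, hence extends to `S`
  have hunits : ∀ y : 𝔔.asIdeal.primeCompl, IsUnit (Ψ y) := fun y => by
    by_contra hy
    have hmem : (y : blowupAlgebra (Ideal.span (Set.range c)) (c 0)) ∈ 𝔑 := by
      rw [h𝔑, Ideal.mem_comap]
      exact (IsLocalRing.mem_maximalIdeal _).mpr hy
    rw [h𝔑𝔔] at hmem
    exact y.2 hmem
  letI := χ.toAlgebra
  haveI : IsLocalization.AtPrime S 𝔔.asIdeal := hloc
  have halg : algebraMap (blowupAlgebra (Ideal.span (Set.range c)) (c 0)) S = χ := rfl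
  let Φ : S →+* O := IsLocalization.lift (M := 𝔔.asIdeal.primeCompl) hunits
  have hΦ : ∀ b, Φ (χ b) = Ψ b := fun b => by
    rw [← halg]; exact IsLocalization.lift_eq hunits b
  have hΦsurj : Function.Surjective Φ := fun o => by
    obtain ⟨b, hb⟩ := hΨsurj o
    exact ⟨χ b, by rw [hΦ, hb]⟩
  have hΦker : RingHom.ker Φ = 𝔞.map χ := by
    apply le_antisymm
    · intro z hz
      rw [RingHom.mem_ker] at hz
      obtain ⟨⟨b, y⟩, hby⟩ := IsLocalization.surj 𝔔.asIdeal.primeCompl z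
      -- `z · χ y = χ b`, `Ψ b = Φ z · Ψ y = 0`
      have hb0 : Ψ b = 0 := by
        have := congrArg Φ hby
        rw [map_mul, hz, zero_mul, halg, hΦ] at this
        exact this.symm
      have hbz : z * χ y ∈ 𝔞.map χ := by
        rw [halg] at hby
        rw [hby]
        exact Ideal.mem_map_of_mem _ ((hΨker b).mp hb0)
      exact (Ideal.mul_unit_mem_iff_mem _ (halg ▸ IsLocalization.map_units S y)).mp hbz
    · rw [Ideal.map_le_iff_le_comap]
      intro b hb
      rw [Ideal.mem_comap, RingHom.mem_ker, hΦ]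
      exact (hΨker b).mpr hb
  exact ⟨(Ideal.quotEquivOfEq hΦker.symm).trans (RingHom.quotientKerEquivOfSurjective hΦsurj)⟩

/-! ## 3. The axis section through the cone point -/

set_option maxHeartbeats 800000 in -- three chart-algebra presentations are threaded through four tree theorems (cf. p542871)
/-- **B6b ★ T-AXIS-SECTION at the cone point (res-type-100's text).** Setting of the centred member of `inv_base`: `O ↠ k` a complete
discrete valuation ring with algebraically closed residue field, `r′ : X′ → Spec O` separated with a section `s`, `τ₁ : X₁ → X′` the
blowing up along `s.ker` with `τ₁ ≫ r′` proper, `j : F₁ → X′` and the point blow-up `υ : F₂ → F₁` of the closed point `x` with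
`j₂ : F₂ → X₁`, `j₂ ≫ τ₁ = υ ≫ j`, `F₂` the special fibre of `τ₁ ≫ r′` (pull-back square `hsq`), `s(s₀) = j x`; a quasi-regular frame
`c = (c₀,c₁,c₂)` of `(ker s)_{jx}` with `𝒪_{X′,jx}/(c) ≃+* O` (`θR`), reducing to a regular system of parameters of `𝒪_{F₁,x}`;
prescribed-germ divisors `L₁, L₂` (`(L_l)_{jx} = (c_l)`); the cone point `p_c = j₂ y′` over `j x` with its chart-`0` presentation
`(𝔔₁, χ₁)`, `χ₁(c_l/c₀) ∈ 𝔪` (B6a), and the downstairs presentation of `𝒪_{F₂,y′}` (`Hp`, B4a). CONCLUSION: a section `s_c` of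
`τ₁ ≫ r′` with `s_c(s₀) = p_c`, `C_axis := ((ker s)·𝒪_{X₁} ⊔ St L₁) ⊔ St L₂ ≤ ker s_c`, `(ker s_c)_{p_c} = χ₁(𝔞)·𝒪 (= (C_axis)_{p_c})`,
`V(ker s_c)` regular and flat over `O`. Assembly: `exists_axisSection` (p542434) with `hsupp` := T-AXIS-SUPPORT, `hfib` := `axis_fibre`,
`eO` := `nonempty_quotient_map_axisIdeal_ringEquiv` after `axis_stalks` (1). [cite: StacksProject, Tag 0804] -/
theorem exists_axisSection_conePoint (O : Type) [CommRing O] [IsDomain O] [IsDiscreteValuationRing O]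
    [IsAdicComplete (maximalIdeal O) O] [IsAlgClosed (ResidueField O)] (k : Type) [Field k]
    (θ : O →+* k) (hθ : Function.Surjective θ)
    {X' X₁ F₁ F₂ : Scheme.{0}} [IsLocallyNoetherian X₁] [IsLocallyNoetherian F₂]
    (r' : X' ⟶ Spec (.of O)) [IsSeparated r'] (s : Spec (.of O) ⟶ X') (hs : s ≫ r' = 𝟙 _)
    {τ₁ : X₁ ⟶ X'} (hτ₁ : IsBlowup τ₁ s.ker) [IsProper (τ₁ ≫ r')]
    (j : F₁ ⟶ X') {x : F₁} (hx : IsClosed ({x} : Set F₁)) {υ : F₂ ⟶ F₁} (hυ : IsBlowup υ (vanishingIdeal ⟨{x}, hx⟩))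
    (j₂ : F₂ ⟶ X₁) (hcomm : j₂ ≫ τ₁ = υ ≫ j) (t₂ : F₂ ⟶ Spec (.of k))
    (hsq : IsPullback j₂ t₂ (τ₁ ≫ r') (Spec.map (CommRingCat.ofHom θ)))
    (hxs : s (closedPoint O) = j x)
    (c : Fin 3 → X'.presheaf.stalk (j x)) (hcJ : Ideal.span (Set.range c) = stalkIdeal s.ker (j x)) (hc : IsQuasiRegular c)
    [IsDomain (X'.presheaf.stalk (j x) ⧸ Ideal.span (Set.range c))]
    [IsRegularRing (X'.presheaf.stalk (j x) ⧸ Ideal.span (Set.range c))]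
    (θR : (X'.presheaf.stalk (j x) ⧸ Ideal.span (Set.range c)) ≃+* O)
    (hcb : Ideal.span (Set.range fun i => (j.stalkMap x).hom (c i)) = maximalIdeal (F₁.presheaf.stalk x))
    (hcbar : IsQuasiRegular (fun i => (j.stalkMap x).hom (c i)))
    (L₁ L₂ : X'.IdealSheafData) (hL₁ : stalkIdeal L₁ (j x) = Ideal.span {c 1}) (hL₂ : stalkIdeal L₂ (j x) = Ideal.span {c 2})
    (y' : F₂) (hy'x : υ y' = x) (hy'cl : IsClosed ({y'} : Set F₂)) (hpc : τ₁ (j₂ y') = j x)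
    -- upstairs presentation at the cone point (B6a `exists_conePoint_presentation`)
    (𝔔₁ : PrimeSpectrum (blowupAlgebra (Ideal.span (Set.range c)) (c 0)))
    (χ₁ : blowupAlgebra (Ideal.span (Set.range c)) (c 0) →+* X₁.presheaf.stalk (j₂ y'))
    (hχ₁ : ∀ a, χ₁ (algebraMap _ _ a) = ((X'.presheaf.stalkCongr (Inseparable.of_eq hpc)).inv ≫ τ₁.stalkMap (j₂ y')).hom a)
    (hloc₁ : @IsLocalization.AtPrime _ _ (X₁.presheaf.stalk (j₂ y')) _ χ₁.toAlgebra 𝔔₁.asIdeal _)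
    (h𝔔₁ : 𝔔₁.asIdeal.comap (algebraMap _ (blowupAlgebra (Ideal.span (Set.range c)) (c 0))) =
      maximalIdeal (X'.presheaf.stalk (j x)))
    (hu : ∀ l : Fin 3, l ≠ 0 → χ₁ (blowupAlgebra.frac c 0 l) ∈ maximalIdeal (X₁.presheaf.stalk (j₂ y')))
    -- downstairs presentation (T-FRAME-AT, packed as output by B4a)
    (Hp : ∃ (𝔔 : PrimeSpectrum (blowupAlgebra (Ideal.span (Set.range fun i => (j.stalkMap x).hom (c i)))
        ((j.stalkMap x).hom (c 0))))
      (χ : blowupAlgebra (Ideal.span (Set.range fun i => (j.stalkMap x).hom (c i))) ((j.stalkMap x).hom (c 0)) →+*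
        F₂.presheaf.stalk y')
      (e : F₂.presheaf.stalk y' ≃+* Localization.AtPrime 𝔔.asIdeal),
      (∀ a, χ (algebraMap _ _ a) = ((F₁.presheaf.stalkCongr (Inseparable.of_eq hy'x)).inv ≫ υ.stalkMap y').hom a) ∧
      @IsLocalization.AtPrime _ _ (F₂.presheaf.stalk y') _ χ.toAlgebra 𝔔.asIdeal _ ∧
      (∀ b, e (χ b) = algebraMap _ (Localization.AtPrime 𝔔.asIdeal) b) ∧
      𝔔.asIdeal.comap (algebraMap _ (blowupAlgebra (Ideal.span (Set.range fun i => (j.stalkMap x).hom (c i)))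
        ((j.stalkMap x).hom (c 0)))) = maximalIdeal (F₁.presheaf.stalk x) ∧
      ∀ (l : {l : Fin 3 // l ≠ 0}) (y : blowupAlgebra (Ideal.span (Set.range fun i => (j.stalkMap x).hom (c i)))
          ((j.stalkMap x).hom (c 0))),
        (y : Localization.Away ((j.stalkMap x).hom (c 0))) =
          algebraMap _ (Localization.Away ((j.stalkMap x).hom (c 0))) ((j.stalkMap x).hom (c l.1)) *
            IsLocalization.Away.invSelf ((j.stalkMap x).hom (c 0)) → y ∈ 𝔔.asIdeal) :
    ∃ s_c : Spec (.of O) ⟶ X₁, s_c ≫ τ₁ ≫ r' = 𝟙 _ ∧ s_c (closedPoint O) = j₂ y' ∧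
      (s.ker.comap τ₁ ⊔ strictTransformIdeal τ₁ s.ker L₁ ⊔ strictTransformIdeal τ₁ s.ker L₂) ≤ s_c.ker ∧
      stalkIdeal s_c.ker (j₂ y') =
        (Ideal.span {algebraMap _ (blowupAlgebra (Ideal.span (Set.range c)) (c 0)) (c 0)} ⊔
          Ideal.span {blowupAlgebra.frac c 0 1, blowupAlgebra.frac c 0 2}).map χ₁ ∧
      Scheme.IsRegular s_c.ker.subscheme ∧ Flat (s_c.ker.subschemeι ≫ τ₁ ≫ r') := by
  -- `j x = s(s₀)` lies on the centre
  have hpJ : j x ∈ (s.ker.support : Set X') := hxs ▸ s.range_subset_ker_support ⟨closedPoint O, rfl⟩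
  -- T-AXIS-STALKS (1)+(2) at the cone point, (3) on the fibre
  obtain ⟨h1, h2⟩ := axis_stalks L₁ L₂ (j₂ y') (j x) hpc hpJ c hcJ hc hL₁ hL₂ 𝔔₁ χ₁ hχ₁ hloc₁ h𝔔₁ hu
  have h3 := axis_fibre L₁ L₂ j hx hυ j₂ hcomm c hcJ hc hcb hcbar hL₁ hL₂ y' hy'x hpc hpJ 𝔔₁ χ₁ hχ₁ hloc₁ h𝔔₁ Hp
  -- `eO : 𝒪_{X₁,p_c} ⧸ (C_axis)_{p_c} ≃+* O`
  obtain ⟨e⟩ := nonempty_quotient_map_axisIdeal_ringEquiv c hc θR 𝔔₁ χ₁ hloc₁ h𝔔₁ hu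
  let eO : (X₁.presheaf.stalk (j₂ y') ⧸
      stalkIdeal ((s.ker.comap τ₁ ⊔ strictTransformIdeal τ₁ s.ker L₁) ⊔ strictTransformIdeal τ₁ s.ker L₂) (j₂ y')) ≃+* O :=
    (Ideal.quotEquivOfEq h1).trans e
  -- `p_c ∈ supp C_axis`
  have hyC : j₂ y' ∈ (((s.ker.comap τ₁ ⊔ strictTransformIdeal τ₁ s.ker L₁) ⊔ strictTransformIdeal τ₁ s.ker L₂).support :
      Set X₁) := by
    rw [SetLike.mem_coe, mem_support_iff_stalkIdeal_le]
    haveI := h2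
    refine IsLocalRing.le_maximalIdeal fun htop => ?_
    exact not_subsingleton _ (Ideal.Quotient.subsingleton_iff.mpr htop)
  -- `V(C_axis · 𝒪_{F₂})` is regular over `y′`
  have hfib : ∀ y'' : ↥(((s.ker.comap τ₁ ⊔ strictTransformIdeal τ₁ s.ker L₁) ⊔ strictTransformIdeal τ₁ s.ker L₂).comap
      j₂).subscheme, (((s.ker.comap τ₁ ⊔ strictTransformIdeal τ₁ s.ker L₁) ⊔ strictTransformIdeal τ₁ s.ker L₂).comap
      j₂).subschemeι y'' = y' → IsRegularLocalRing ((((s.ker.comap τ₁ ⊔ strictTransformIdeal τ₁ s.ker L₁) ⊔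
      strictTransformIdeal τ₁ s.ker L₂).comap j₂).subscheme.presheaf.stalk y'') := fun y'' hy'' =>
    isRegularLocalRing_stalk_subscheme_of_stalkIdeal_eq_maximalIdeal _ y' h3 y'' hy''
  -- the only special point of the axis is the cone point (T-AXIS-SUPPORT)
  have hsupp := eq_conePoint_of_mem_support_axis_of_apply_eq_closedPoint r' s hs hτ₁ hxs c hcJ hpc 𝔔₁ χ₁ hχ₁ hloc₁
    h𝔔₁ hu L₁ L₂ hL₁ hL₂
  obtain ⟨s_c, hsc, hpt, hle, hst, hreg, hflat⟩ := exists_axisSection O k θ hθ X₁ F₂ (τ₁ ≫ r') j₂ t₂ hsq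
    ((s.ker.comap τ₁ ⊔ strictTransformIdeal τ₁ s.ker L₁) ⊔ strictTransformIdeal τ₁ s.ker L₂) y' hy'cl hyC hsupp eO hfib
  exact ⟨s_c, hsc, hpt, hle, hst.trans h1, hreg, hflat⟩

end Summit.ResolutionOfSingularities.ResolutionOfSingularities.Cruxes.EquisingularLiftNat.Sections

end
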